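/-
Copyright (c) 2026 the pub-hodgecm-mathlib formalisation cell (harness21).  Prover seat hodgecm-mathlib-LH4-p10 (g5), req620 Track A «(D-RAM) FOUR-FRAME» squad, helper lane
on h413 = stmt-HodgeConjecture-24833 (count-neutral).  STAGE-1b scoping brick (N-vol-sgn′) FILE 4e (dealer LH4-plan (g12∕g13) board «(N-vol) p10»; readers LH4-p11 (g7)
★ p859319 (J-T+-derived), LH4-p05 (g8) (β), LH4-p08 (g7) row (3), LH4-p13 (g8) (α)): THE CLEAN SIGN PIECE HAS ZERO UNIPOTENT-FIBRE VOLUME.  2026-09-04.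
-/
import Summits.HodgeConjecture.HodgeConjecture.Theorems.F0P3cDyRamTransvMinusUnipotentVolume   -- ★ p859426 FILE 4d (this seat): set algebra ∕ measurability ∕ finiteness on `N`, `NNReal.inv_pow_sub_inv_pow_succ`; brings ★ p859349 (ρ_{T+}), ★ p859102, ★ FILE 4b∕1
import HarnessLib

/-!
# Crux `H413`, line LH4 «(D-RAM) FOUR-FRAME» — THE CLEAN SIGN PIECE HAS ZERO UNIPOTENT-FIBRE VOLUME:
# `μ_N{n ∈ K₃ : shell(ℓ₀, m_c) ∧ ¬LabelPlus(m*)} = μ_N{n ∈ K₃ : shell(ℓ₀, m_c) ∧ LabelPlus(m*)} = ½(1 − q⁻¹)·q^{−(k_c − ⌊d∕2⌋)}·μ_N{n ∈ K₃}` (`d ≥ 2`, every Haar `μ_N`)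

Cell `hodgecm-mathlib` (D-0151), FLOOR 0, crux item H413 = `stmt-HodgeConjecture-24833`, route of record `HCCMUnconditional`; squad F0∕P3c∕LH4 (req618∕req620); helper lane
`--supports stmt-HodgeConjecture-24833 --as helper` (count-neutral).  THEOREMS ONLY (no `def`, no instance, no notation, no `sorry`).

WHAT.  At a WILD ramified non-split CM place `w ∣ v` (`IsRamifiedQuadraticDatum σ_w ϖ d t`; `ℓ₀ = d % 2`, `m* = ℓ₀ + 2d − 1`, `k_c = (ℓ₀ + 3d − 1)∕2 = ⌊(m* + d)∕2⌋`, CLEAN square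
level `m_c = 2·k_c` — the value of the derived road's `mcOfRecord = 2⌊(m* + d)∕2⌋`, `q = N𝔭_v`), for EVERY Haar measure `μ_N` of `N = unipotentU (c ⊗ 1) Φ₃`, `X = n_w − 1`:
* §2 **(α) «LabelPlus IS CLEAN» AS A SET IDENTITY ON `N`** (every `d ≥ 1`): `{n ∈ K₃ : shell(ℓ₀, m_c) X ∧ LabelPlus(m*) X} = {n ∈ K₃ : shell(ℓ₀, m*) X ∧ LabelPlus(m*) X}` — `⊇` is
  ★ p859349 `not_labelPlus_chart_of_not_clean` (a labelled shell point has `|x_w| ≤ |ϖ|^{k_c}`, i.e. `X² ∈ ϖ^{m_c} M₃`) through the chart ★ p859078∕p859059, `⊆` is `m* ≤ m_c`;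
* §3 `μ_N{n ∈ K₃ : shell(ℓ₀, m_c)} = ((1 − q⁻¹)·(q^{k_c − ⌊d∕2⌋})⁻¹) • μ_N{n ∈ K₃}` (the CLEAN shell = `levels(ℓ₀, m_c) ∖ levels(ℓ₀+1, m_c)`, ★ p859102; `d ≥ 2`) — TWICE `ρ_{T+}`;
* §4 `μ_N{n ∈ K₃ : shell(ℓ₀, m_c) ∧ LabelPlus(m*)} = ((1 − q⁻¹)∕2·(q^{k_c − ⌊d∕2⌋})⁻¹) • μ_N{n ∈ K₃}` (§2 + ★ p859349) and **the same for `¬LabelPlus(m*)`** (§3 − §4): on the clean shell the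
  two label classes have EQUAL unipotent-fibre volume (★ p859184's norm-class halving, fibrewise);
* §5 `μ_N.real` forms and **`μ_N.real{clean shell ∧ LabelPlus} − μ_N.real{clean shell ∧ ¬LabelPlus} = 0`** — i.e. `∫_N f_sgn′ = 0` for the derived road's clean sign piece
  `f_sgn′ := f_{T+} − 𝟙{K ∧ shell(ℓ₀, m_c) ∧ ¬LabelPlus(m*)}` (LH4-p11 (g7) ★ p859319; by §2, `f_{T+} = 𝟙{K ∧ shell(ℓ₀, m_c) ∧ LabelPlus(m*)}`), so the Levi row (3) of `f_sgn′`
  VANISHES near `1` through LH4-p08 (g7)'s ★ p858898∕p858969 chain and is realised by the EMPTY `H`-family ((β) at the Levi population).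
Measurability of all these sets: ★ p859426 `measurableSet_setOf_mem_and_nearTransvShell[_and_labelPlus∕_and_not_labelPlus]` (any `ℓ m d m′`).
HONEST LABEL: count-neutral scoping, pays no row by itself, states no census law; HC_CM is proved only modulo the 7 printed citations (2 remaining named inputs: hLiu418 =
`stmt-HodgeConjecture-24832`, h413 = `stmt-HodgeConjecture-24833`) until rung 0 closes.

## References
* [Rogawski1990] J. D. Rogawski, *Automorphic Representations of Unitary Groups in Three Variables*, Ann. of Math. Stud. 123 (1990), §4.9 Prop. 4.9.1 (b) p. 55; §1.10 p. 9.
* [Serre1979] J.-P. Serre, *Local Fields*, GTM 67 (1979), Ch. V §3 Cor. 3, Ch. XV §2 (norm classes, conductor).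
* [Kottwitz1986BaseChangeUnits] R. E. Kottwitz, *Base change for unit elements of Hecke algebras*, Compositio Math. 60 (1986), §1 pp. 240–241 (level pieces, fibre volumes).
* [LanglandsShelstad1987] R. P. Langlands, D. Shelstad, *On the definition of transfer factors*, Math. Ann. 278 (1987), §3 (the two unipotent classes, `κ`-sign).
-/

set_option autoImplicit false

noncomputable section

open IsDedekindDomain NumberField Matrix MeasureTheory Measure Topology
open scoped NumberField MatrixGroups Matrix NNReal ENNReal WithZero Pointwise Valued

namespace Summit.HodgeConjecture.HodgeConjecture.Cruxes.H413.F0P3cDyRamCleanSignUnipotentVolume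

open Literature.NumberTheory.Automorphic Literature.NumberTheory.Automorphic.UnitaryGroup Literature.NumberTheory.Automorphic.IntegralReduction
open Literature.NumberTheory.Automorphic.UnitaryLatticeTree Literature.NumberTheory.Automorphic.HermitianLattice
open Literature.NumberTheory.GaloisRepresentations Literature.NumberTheory.LocalFields
open Summit.HodgeConjecture.HodgeConjecture.Cruxes.H413.F0P3cDyRamFourFramePieces
open Summit.HodgeConjecture.HodgeConjecture.Cruxes.H413.F0P3cDyRamUnipotentLabelLocus
open Summit.HodgeConjecture.HodgeConjecture.Cruxes.H413.F0P3cDyRamTransvPlusUnipotentVolume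
open Summit.HodgeConjecture.HodgeConjecture.Cruxes.H413.F0P3cDyRamTransvMinusUnipotentVolume

variable (L : Type) [Field L] [NumberField L] [IsCMField L] (v : HeightOneSpectrum (𝓞 ↥(maximalRealSubfield L)))
  (w : PlacesOver L v) (hw : IsCMField.complexConj L • w.1 = w.1)

/-! ## §1 Scalar bookkeeping -/

/-- `a·P − (a∕2)·P = (a∕2)·P` in `ℝ≥0`. -/
theorem NNReal.mul_sub_half_mul (a P : ℝ≥0) : a * P - a / 2 * P = a / 2 * P := by
  have hle : a / 2 * P ≤ a * P := mul_le_mul_of_nonneg_right (div_le_self zero_le one_le_two) zero_le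
  apply NNReal.eq
  rw [NNReal.coe_sub hle]
  push_cast
  ring

/-! ## §2 (α) «LabelPlus is clean» as a set identity on `N` -/

include hw in
/-- **(α) ON `N`: a labelled shell point is CLEAN.**  `{n ∈ K₃ : NearTransvShell ϖ ℓ₀ m_c (n_w − 1) ∧ LabelPlus σ_w ϖ d m* (n_w − 1)} = {n ∈ K₃ : NearTransvShell ϖ ℓ₀ m* (n_w − 1) ∧ LabelPlus … }`
with `m_c = 2·((ℓ₀ + 3d − 1)∕2)`, `m* = ℓ₀ + 2d − 1` (every `d ≥ 1`): in the chart `n = u(x, z)` the square level of `X = n_w − 1` is `|x_w| ≤ |ϖ|^{⌈m∕2⌉}` (★ p859059), and a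
`LabelPlus` point of the `m*`-shell has `|x_w| ≤ |ϖ|^{k_c}` (★ p859349 `not_labelPlus_chart_of_not_clean` ← ★ p859171 `not_labelPlus_heis_of_shallow`).
[cite: Rogawski1990, §4.9 Prop. 4.9.1 (b) p. 55; §1.10 p. 9] [cite: Serre1979, Ch. XV §2] -/
theorem setOf_mem_and_cleanShell_and_labelPlus_eq {ϖ : w.1.adicCompletion L} {d t : ℕ}
    (hD : UnitaryThreeFourFrame.IsRamifiedQuadraticDatum (galAdicCompletionMap (L := L) (IsCMField.complexConj L) hw) ϖ d t) :
    {n : ↥(unipotentU (conjLocal L (IsCMField.complexConj L) v) (cmLocalForm L 3 v)) |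
        (n : ↥(unitaryGroupOfForm (conjLocal L (IsCMField.complexConj L) v) (cmLocalForm L 3 v))) ∈
            cmLocalIntegralLevel L 3 (Matrix.of fun i j : Fin 3 => if i.val + j.val + 1 = 3 then (1 : L) else 0) v ∧
          NearTransvShell ϖ (d % 2) (2 * ((d % 2 + 3 * d - 1) / 2))
            (((n : ↥(unitaryGroupOfForm (conjLocal L (IsCMField.complexConj L) v) (cmLocalForm L 3 v))) : GL (Fin 3) (LocalRing L v)).val.map
                (Pi.evalRingHom (fun w' : PlacesOver L v => w'.1.adicCompletion L) w) - 1) ∧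
          LabelPlus (galAdicCompletionMap (L := L) (IsCMField.complexConj L) hw) ϖ d (d % 2 + 2 * d - 1)
            (((n : ↥(unitaryGroupOfForm (conjLocal L (IsCMField.complexConj L) v) (cmLocalForm L 3 v))) : GL (Fin 3) (LocalRing L v)).val.map
                (Pi.evalRingHom (fun w' : PlacesOver L v => w'.1.adicCompletion L) w) - 1)} =
      {n : ↥(unipotentU (conjLocal L (IsCMField.complexConj L) v) (cmLocalForm L 3 v)) |
        (n : ↥(unitaryGroupOfForm (conjLocal L (IsCMField.complexConj L) v) (cmLocalForm L 3 v))) ∈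
            cmLocalIntegralLevel L 3 (Matrix.of fun i j : Fin 3 => if i.val + j.val + 1 = 3 then (1 : L) else 0) v ∧
          NearTransvShell ϖ (d % 2) (d % 2 + 2 * d - 1)
            (((n : ↥(unitaryGroupOfForm (conjLocal L (IsCMField.complexConj L) v) (cmLocalForm L 3 v))) : GL (Fin 3) (LocalRing L v)).val.map
                (Pi.evalRingHom (fun w' : PlacesOver L v => w'.1.adicCompletion L) w) - 1) ∧
          LabelPlus (galAdicCompletionMap (L := L) (IsCMField.complexConj L) hw) ϖ d (d % 2 + 2 * d - 1)
            (((n : ↥(unitaryGroupOfForm (conjLocal L (IsCMField.complexConj L) v) (cmLocalForm L 3 v))) : GL (Fin 3) (LocalRing L v)).val.map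
                (Pi.evalRingHom (fun w' : PlacesOver L v => w'.1.adicCompletion L) w) - 1)} := by
  letI : Invertible (2 : LocalRing L v) := (isUnit_two_localRing L v).invertible
  have hϖ : Valued.v ϖ = WithZero.exp (-1 : ℤ) := hD.2.2.1
  have hσw : ∀ r : LocalRing L v, conjLocal L (IsCMField.complexConj L) v r w = galAdicCompletionMap (L := L) (IsCMField.complexConj L) hw (r w) :=
    fun r => conjLocal_apply_eq_of_smul_eq (IsCMField.complexConj L) (IsCMField.complexConj_ne_one L) v w hw r
  have hk1 : (2 * ((d % 2 + 3 * d - 1) / 2) + 1) / 2 = (d % 2 + 3 * d - 1) / 2 := by omega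
  have hle : WithZero.exp (-(((d % 2 + 3 * d - 1) / 2 : ℕ) : ℤ)) ≤ WithZero.exp (-(((d % 2 + 2 * d - 1 + 1) / 2 : ℕ) : ℤ)) :=
    WithZero.exp_le_exp.2 (by push_cast; omega)
  ext n
  obtain ⟨⟨x, y⟩, rfl⟩ := (HeisRing.heisHomeomorph (conjLocal L (IsCMField.complexConj L) v) (conjLocal_conjLocal_cm L v)
    (continuous_conjLocal L (IsCMField.complexConj L) v) (cmLocalForm_eq_over L 3 v)).surjective n
  simp only [Set.mem_setOf_eq, HeisRing.heisHomeomorph_apply, NearTransvShell, InLevel]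
  rw [forall_valued_map_heisElt_sub_one_mul_self_le_iff L v w hw hϖ (2 * ((d % 2 + 3 * d - 1) / 2)) x y,
    forall_valued_map_heisElt_sub_one_mul_self_le_iff L v w hw hϖ (d % 2 + 2 * d - 1) x y, map_heisElt_sub_one_eq L v w x y, hσw x, hk1]
  constructor
  · rintro ⟨hK, ⟨hA, hB, hx⟩, hL⟩
    exact ⟨hK, ⟨hA, hB, hx.trans hle⟩, hL⟩
  · rintro ⟨hK, ⟨hA, hB, -⟩, hL⟩
    exact ⟨hK, ⟨hA, hB, by_contra fun hx' => not_labelPlus_chart_of_not_clean L v w hw hD hx' y hL⟩, hL⟩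

/-! ## §3 The clean shell volume (= twice `ρ_{T+}`) -/

include hw in
/-- **THE CLEAN SHELL FIBRE VOLUME.**  At a WILD ramified non-split place (`IsRamifiedQuadraticDatum σ_w ϖ d t`, `2 ≤ d`), for EVERY Haar measure `μ_N` of `N`:
`μ_N{n ∈ K₃ : NearTransvShell ϖ (d%2) (2·((d%2+3d−1)∕2)) (n_w − 1)} = ((1 − q⁻¹)·(q^{(d%2+3d−1)∕2 − d∕2})⁻¹) • μ_N{n ∈ K₃}` (clean shell = `levels(ℓ₀, m_c) ∖ levels(ℓ₀+1, m_c)`,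
★ p859102 at exponents `k_c − ⌊d∕2⌋`, `k_c − ⌊d∕2⌋ + 1`) — TWICE the labelled volume ★ p859349.
[cite: Kottwitz1986BaseChangeUnits, §1 pp. 240–241] [cite: Rogawski1990, §4.9 Prop. 4.9.1 (b) p. 55] -/
theorem measure_setOf_mem_and_cleanShell_eq [MeasurableSpace ↥(unipotentU (conjLocal L (IsCMField.complexConj L) v) (cmLocalForm L 3 v))] [BorelSpace ↥(unipotentU (conjLocal L (IsCMField.complexConj L) v) (cmLocalForm L 3 v))]
    (μN : Measure ↥(unipotentU (conjLocal L (IsCMField.complexConj L) v) (cmLocalForm L 3 v))) [μN.IsHaarMeasure]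
    (he : v.asIdeal.ramificationIdx' w.1.asIdeal ≠ 1) {ϖ : w.1.adicCompletion L} {d t : ℕ}
    (hD : UnitaryThreeFourFrame.IsRamifiedQuadraticDatum (galAdicCompletionMap (L := L) (IsCMField.complexConj L) hw) ϖ d t) (h2d : 2 ≤ d) :
    μN {n : ↥(unipotentU (conjLocal L (IsCMField.complexConj L) v) (cmLocalForm L 3 v)) |
        (n : ↥(unitaryGroupOfForm (conjLocal L (IsCMField.complexConj L) v) (cmLocalForm L 3 v))) ∈
            cmLocalIntegralLevel L 3 (Matrix.of fun i j : Fin 3 => if i.val + j.val + 1 = 3 then (1 : L) else 0) v ∧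
          NearTransvShell ϖ (d % 2) (2 * ((d % 2 + 3 * d - 1) / 2))
            (((n : ↥(unitaryGroupOfForm (conjLocal L (IsCMField.complexConj L) v) (cmLocalForm L 3 v))) : GL (Fin 3) (LocalRing L v)).val.map
                (Pi.evalRingHom (fun w' : PlacesOver L v => w'.1.adicCompletion L) w) - 1)} =
      (((1 - ((Ideal.absNorm v.asIdeal : ℝ≥0))⁻¹) * ((Ideal.absNorm v.asIdeal : ℝ≥0) ^ ((d % 2 + 3 * d - 1) / 2 - d / 2))⁻¹ : ℝ≥0)) •
        μN {n : ↥(unipotentU (conjLocal L (IsCMField.complexConj L) v) (cmLocalForm L 3 v)) | (n : ↥(unitaryGroupOfForm (conjLocal L (IsCMField.complexConj L) v) (cmLocalForm L 3 v))) ∈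
          cmLocalIntegralLevel L 3 (Matrix.of fun i j : Fin 3 => if i.val + j.val + 1 = 3 then (1 : L) else 0) v} := by
  have hϖ : Valued.v ϖ = WithZero.exp (-1 : ℤ) := hD.2.2.1
  have hfin := (measure_setOf_mem_cmLocalIntegralLevel_lt_top L v μN).ne
  have hmono : ∀ e : w.1.adicCompletion L, Valued.v ((ϖ ^ (d % 2 + 1))⁻¹ * e) ≤ 1 → Valued.v ((ϖ ^ (d % 2))⁻¹ * e) ≤ 1 := fun e he1 =>
    (valued_inv_pow_mul_le_one_iff hϖ _ e).2 (((valued_inv_pow_mul_le_one_iff hϖ _ e).1 he1).trans (WithZero.exp_le_exp.2 (by push_cast; omega)))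
  have e1 : (max (max (d % 2) ((2 * ((d % 2 + 3 * d - 1) / 2) + 1) / 2)) ((d % 2 + d) / 2) - d / 2) + (d % 2 - d % 2 + 1) / 2 =
      (d % 2 + 3 * d - 1) / 2 - d / 2 := by omega
  have e2 : (max (max (d % 2 + 1) ((2 * ((d % 2 + 3 * d - 1) / 2) + 1) / 2)) ((d % 2 + 1 + d) / 2) - d / 2) + (d % 2 + 1 - d % 2 + 1) / 2 =
      (d % 2 + 3 * d - 1) / 2 - d / 2 + 1 := by omega
  rw [setOf_mem_and_nearTransvShell_eq_diff L v w ϖ, measure_sdiff ?_ (isClosed_setOf_mem_and_levels L v w hw hϖ _ _).measurableSet.nullMeasurableSet ?_,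
    measure_setOf_mem_and_levels_eq L v w hw μN he hD, measure_setOf_mem_and_levels_eq L v w hw μN he hD, e1, e2,
    ENNReal.sub_smul_of_ne_top _ _ hfin, NNReal.inv_pow_sub_inv_pow_succ (one_le_absNorm_nnreal L v)]
  · exact fun n hn => ⟨hn.1, fun i j => hmono _ (hn.2.1 i j), hn.2.2⟩
  · exact measure_ne_top_of_subset (fun n hn => hn.1) hfin

/-! ## §4 The two label classes of the clean shell have EQUAL volume `ρ_{T+}·μ_N{n ∈ K₃}` -/

include hw in
/-- **The `LabelPlus` class of the CLEAN shell** has volume `((1 − q⁻¹)∕2·(q^{(d%2+3d−1)∕2 − d∕2})⁻¹) • μ_N{n ∈ K₃}` (it IS the labelled `m*`-shell set, §2; ★ p859349).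
[cite: Rogawski1990, §4.9 Prop. 4.9.1 (b) p. 55] [cite: LanglandsShelstad1987, §3] -/
theorem measure_setOf_mem_and_cleanShell_and_labelPlus_eq [MeasurableSpace ↥(unipotentU (conjLocal L (IsCMField.complexConj L) v) (cmLocalForm L 3 v))] [BorelSpace ↥(unipotentU (conjLocal L (IsCMField.complexConj L) v) (cmLocalForm L 3 v))]
    (μN : Measure ↥(unipotentU (conjLocal L (IsCMField.complexConj L) v) (cmLocalForm L 3 v))) [μN.IsHaarMeasure]
    (he : v.asIdeal.ramificationIdx' w.1.asIdeal ≠ 1) {ϖ : w.1.adicCompletion L} {d t : ℕ}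
    (hD : UnitaryThreeFourFrame.IsRamifiedQuadraticDatum (galAdicCompletionMap (L := L) (IsCMField.complexConj L) hw) ϖ d t) (h2d : 2 ≤ d) :
    μN {n : ↥(unipotentU (conjLocal L (IsCMField.complexConj L) v) (cmLocalForm L 3 v)) |
        (n : ↥(unitaryGroupOfForm (conjLocal L (IsCMField.complexConj L) v) (cmLocalForm L 3 v))) ∈
            cmLocalIntegralLevel L 3 (Matrix.of fun i j : Fin 3 => if i.val + j.val + 1 = 3 then (1 : L) else 0) v ∧
          NearTransvShell ϖ (d % 2) (2 * ((d % 2 + 3 * d - 1) / 2))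
            (((n : ↥(unitaryGroupOfForm (conjLocal L (IsCMField.complexConj L) v) (cmLocalForm L 3 v))) : GL (Fin 3) (LocalRing L v)).val.map
                (Pi.evalRingHom (fun w' : PlacesOver L v => w'.1.adicCompletion L) w) - 1) ∧
          LabelPlus (galAdicCompletionMap (L := L) (IsCMField.complexConj L) hw) ϖ d (d % 2 + 2 * d - 1)
            (((n : ↥(unitaryGroupOfForm (conjLocal L (IsCMField.complexConj L) v) (cmLocalForm L 3 v))) : GL (Fin 3) (LocalRing L v)).val.map
                (Pi.evalRingHom (fun w' : PlacesOver L v => w'.1.adicCompletion L) w) - 1)} =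
      ((((1 - ((Ideal.absNorm v.asIdeal : ℝ≥0))⁻¹) / 2) * ((Ideal.absNorm v.asIdeal : ℝ≥0) ^ ((d % 2 + 3 * d - 1) / 2 - d / 2))⁻¹ : ℝ≥0)) •
        μN {n : ↥(unipotentU (conjLocal L (IsCMField.complexConj L) v) (cmLocalForm L 3 v)) | (n : ↥(unitaryGroupOfForm (conjLocal L (IsCMField.complexConj L) v) (cmLocalForm L 3 v))) ∈
          cmLocalIntegralLevel L 3 (Matrix.of fun i j : Fin 3 => if i.val + j.val + 1 = 3 then (1 : L) else 0) v} := by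
  rw [setOf_mem_and_cleanShell_and_labelPlus_eq L v w hw hD]
  exact measure_setOf_mem_and_nearTransvShell_and_labelPlus_eq L v w hw μN he hD h2d

include hw in
/-- **The `¬LabelPlus` class of the CLEAN shell — the derived road's `T−′` — has the SAME volume** `((1 − q⁻¹)∕2·(q^{(d%2+3d−1)∕2 − d∕2})⁻¹) • μ_N{n ∈ K₃}` (§3 − §4: clean shell
minus its plus class; fibrewise this is ★ p859184's norm-class halving).  [cite: Rogawski1990, §4.9 Prop. 4.9.1 (b) p. 55] [cite: Serre1979, Ch. V §3 Cor. 3] [cite: LanglandsShelstad1987, §3] -/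
theorem measure_setOf_mem_and_cleanShell_and_not_labelPlus_eq [MeasurableSpace ↥(unipotentU (conjLocal L (IsCMField.complexConj L) v) (cmLocalForm L 3 v))] [BorelSpace ↥(unipotentU (conjLocal L (IsCMField.complexConj L) v) (cmLocalForm L 3 v))]
    (μN : Measure ↥(unipotentU (conjLocal L (IsCMField.complexConj L) v) (cmLocalForm L 3 v))) [μN.IsHaarMeasure]
    (he : v.asIdeal.ramificationIdx' w.1.asIdeal ≠ 1) {ϖ : w.1.adicCompletion L} {d t : ℕ}
    (hD : UnitaryThreeFourFrame.IsRamifiedQuadraticDatum (galAdicCompletionMap (L := L) (IsCMField.complexConj L) hw) ϖ d t) (h2d : 2 ≤ d) :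
    μN {n : ↥(unipotentU (conjLocal L (IsCMField.complexConj L) v) (cmLocalForm L 3 v)) |
        (n : ↥(unitaryGroupOfForm (conjLocal L (IsCMField.complexConj L) v) (cmLocalForm L 3 v))) ∈
            cmLocalIntegralLevel L 3 (Matrix.of fun i j : Fin 3 => if i.val + j.val + 1 = 3 then (1 : L) else 0) v ∧
          NearTransvShell ϖ (d % 2) (2 * ((d % 2 + 3 * d - 1) / 2))
            (((n : ↥(unitaryGroupOfForm (conjLocal L (IsCMField.complexConj L) v) (cmLocalForm L 3 v))) : GL (Fin 3) (LocalRing L v)).val.map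
                (Pi.evalRingHom (fun w' : PlacesOver L v => w'.1.adicCompletion L) w) - 1) ∧
          ¬ LabelPlus (galAdicCompletionMap (L := L) (IsCMField.complexConj L) hw) ϖ d (d % 2 + 2 * d - 1)
            (((n : ↥(unitaryGroupOfForm (conjLocal L (IsCMField.complexConj L) v) (cmLocalForm L 3 v))) : GL (Fin 3) (LocalRing L v)).val.map
                (Pi.evalRingHom (fun w' : PlacesOver L v => w'.1.adicCompletion L) w) - 1)} =
      ((((1 - ((Ideal.absNorm v.asIdeal : ℝ≥0))⁻¹) / 2) * ((Ideal.absNorm v.asIdeal : ℝ≥0) ^ ((d % 2 + 3 * d - 1) / 2 - d / 2))⁻¹ : ℝ≥0)) •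
        μN {n : ↥(unipotentU (conjLocal L (IsCMField.complexConj L) v) (cmLocalForm L 3 v)) | (n : ↥(unitaryGroupOfForm (conjLocal L (IsCMField.complexConj L) v) (cmLocalForm L 3 v))) ∈
          cmLocalIntegralLevel L 3 (Matrix.of fun i j : Fin 3 => if i.val + j.val + 1 = 3 then (1 : L) else 0) v} := by
  have hϖ : Valued.v ϖ = WithZero.exp (-1 : ℤ) := hD.2.2.1
  have hfin := (measure_setOf_mem_cmLocalIntegralLevel_lt_top L v μN).ne
  rw [setOf_mem_and_nearTransvShell_and_not_labelPlus_eq_diff L v w hw ϖ,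
    measure_sdiff ?_ (measurableSet_setOf_mem_and_nearTransvShell_and_labelPlus L v w hw hϖ _ _ _ _).nullMeasurableSet ?_,
    measure_setOf_mem_and_cleanShell_eq L v w hw μN he hD h2d, measure_setOf_mem_and_cleanShell_and_labelPlus_eq L v w hw μN he hD h2d,
    ENNReal.sub_smul_of_ne_top _ _ hfin, NNReal.mul_sub_half_mul]
  · exact fun n hn => ⟨hn.1, hn.2.1⟩
  · exact measure_ne_top_of_subset (fun n hn => hn.1) hfin

include hw in
/-- **THE CLEAN SIGN PIECE IS BALANCED ON `N`**: `μ_N{n ∈ K₃ : clean shell ∧ LabelPlus(m*)} = μ_N{n ∈ K₃ : clean shell ∧ ¬LabelPlus(m*)}`.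
[cite: LanglandsShelstad1987, §3] [cite: Rogawski1990, §4.9 Prop. 4.9.1 (b) p. 55] -/
theorem measure_setOf_mem_and_cleanShell_and_labelPlus_eq_not_labelPlus [MeasurableSpace ↥(unipotentU (conjLocal L (IsCMField.complexConj L) v) (cmLocalForm L 3 v))] [BorelSpace ↥(unipotentU (conjLocal L (IsCMField.complexConj L) v) (cmLocalForm L 3 v))]
    (μN : Measure ↥(unipotentU (conjLocal L (IsCMField.complexConj L) v) (cmLocalForm L 3 v))) [μN.IsHaarMeasure]
    (he : v.asIdeal.ramificationIdx' w.1.asIdeal ≠ 1) {ϖ : w.1.adicCompletion L} {d t : ℕ}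
    (hD : UnitaryThreeFourFrame.IsRamifiedQuadraticDatum (galAdicCompletionMap (L := L) (IsCMField.complexConj L) hw) ϖ d t) (h2d : 2 ≤ d) :
    μN {n : ↥(unipotentU (conjLocal L (IsCMField.complexConj L) v) (cmLocalForm L 3 v)) |
        (n : ↥(unitaryGroupOfForm (conjLocal L (IsCMField.complexConj L) v) (cmLocalForm L 3 v))) ∈
            cmLocalIntegralLevel L 3 (Matrix.of fun i j : Fin 3 => if i.val + j.val + 1 = 3 then (1 : L) else 0) v ∧
          NearTransvShell ϖ (d % 2) (2 * ((d % 2 + 3 * d - 1) / 2))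
            (((n : ↥(unitaryGroupOfForm (conjLocal L (IsCMField.complexConj L) v) (cmLocalForm L 3 v))) : GL (Fin 3) (LocalRing L v)).val.map
                (Pi.evalRingHom (fun w' : PlacesOver L v => w'.1.adicCompletion L) w) - 1) ∧
          LabelPlus (galAdicCompletionMap (L := L) (IsCMField.complexConj L) hw) ϖ d (d % 2 + 2 * d - 1)
            (((n : ↥(unitaryGroupOfForm (conjLocal L (IsCMField.complexConj L) v) (cmLocalForm L 3 v))) : GL (Fin 3) (LocalRing L v)).val.map
                (Pi.evalRingHom (fun w' : PlacesOver L v => w'.1.adicCompletion L) w) - 1)} =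
      μN {n : ↥(unipotentU (conjLocal L (IsCMField.complexConj L) v) (cmLocalForm L 3 v)) |
        (n : ↥(unitaryGroupOfForm (conjLocal L (IsCMField.complexConj L) v) (cmLocalForm L 3 v))) ∈
            cmLocalIntegralLevel L 3 (Matrix.of fun i j : Fin 3 => if i.val + j.val + 1 = 3 then (1 : L) else 0) v ∧
          NearTransvShell ϖ (d % 2) (2 * ((d % 2 + 3 * d - 1) / 2))
            (((n : ↥(unitaryGroupOfForm (conjLocal L (IsCMField.complexConj L) v) (cmLocalForm L 3 v))) : GL (Fin 3) (LocalRing L v)).val.map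
                (Pi.evalRingHom (fun w' : PlacesOver L v => w'.1.adicCompletion L) w) - 1) ∧
          ¬ LabelPlus (galAdicCompletionMap (L := L) (IsCMField.complexConj L) hw) ϖ d (d % 2 + 2 * d - 1)
            (((n : ↥(unitaryGroupOfForm (conjLocal L (IsCMField.complexConj L) v) (cmLocalForm L 3 v))) : GL (Fin 3) (LocalRing L v)).val.map
                (Pi.evalRingHom (fun w' : PlacesOver L v => w'.1.adicCompletion L) w) - 1)} := by
  rw [measure_setOf_mem_and_cleanShell_and_labelPlus_eq L v w hw μN he hD h2d, measure_setOf_mem_and_cleanShell_and_not_labelPlus_eq L v w hw μN he hD h2d]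

/-! ## §5 `μ_N.real` currency and `∫_N f_sgn′ = 0` -/

include hw in
/-- `μ_N.real{n ∈ K₃ : clean shell ∧ LabelPlus(m*)} = ((1 − q⁻¹)∕2·(q^{(d%2+3d−1)∕2 − d∕2})⁻¹)·μ_N.real{n ∈ K₃}`. [cite: Rogawski1990, §4.9 Prop. 4.9.1 (b) p. 55] -/
theorem measureReal_setOf_mem_and_cleanShell_and_labelPlus_eq [MeasurableSpace ↥(unipotentU (conjLocal L (IsCMField.complexConj L) v) (cmLocalForm L 3 v))] [BorelSpace ↥(unipotentU (conjLocal L (IsCMField.complexConj L) v) (cmLocalForm L 3 v))]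
    (μN : Measure ↥(unipotentU (conjLocal L (IsCMField.complexConj L) v) (cmLocalForm L 3 v))) [μN.IsHaarMeasure]
    (he : v.asIdeal.ramificationIdx' w.1.asIdeal ≠ 1) {ϖ : w.1.adicCompletion L} {d t : ℕ}
    (hD : UnitaryThreeFourFrame.IsRamifiedQuadraticDatum (galAdicCompletionMap (L := L) (IsCMField.complexConj L) hw) ϖ d t) (h2d : 2 ≤ d) :
    μN.real {n : ↥(unipotentU (conjLocal L (IsCMField.complexConj L) v) (cmLocalForm L 3 v)) |
        (n : ↥(unitaryGroupOfForm (conjLocal L (IsCMField.complexConj L) v) (cmLocalForm L 3 v))) ∈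
            cmLocalIntegralLevel L 3 (Matrix.of fun i j : Fin 3 => if i.val + j.val + 1 = 3 then (1 : L) else 0) v ∧
          NearTransvShell ϖ (d % 2) (2 * ((d % 2 + 3 * d - 1) / 2))
            (((n : ↥(unitaryGroupOfForm (conjLocal L (IsCMField.complexConj L) v) (cmLocalForm L 3 v))) : GL (Fin 3) (LocalRing L v)).val.map
                (Pi.evalRingHom (fun w' : PlacesOver L v => w'.1.adicCompletion L) w) - 1) ∧
          LabelPlus (galAdicCompletionMap (L := L) (IsCMField.complexConj L) hw) ϖ d (d % 2 + 2 * d - 1)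
            (((n : ↥(unitaryGroupOfForm (conjLocal L (IsCMField.complexConj L) v) (cmLocalForm L 3 v))) : GL (Fin 3) (LocalRing L v)).val.map
                (Pi.evalRingHom (fun w' : PlacesOver L v => w'.1.adicCompletion L) w) - 1)} =
      ((1 - ((Ideal.absNorm v.asIdeal : ℝ))⁻¹) / 2 * ((Ideal.absNorm v.asIdeal : ℝ) ^ ((d % 2 + 3 * d - 1) / 2 - d / 2))⁻¹) *
        μN.real {n : ↥(unipotentU (conjLocal L (IsCMField.complexConj L) v) (cmLocalForm L 3 v)) | (n : ↥(unitaryGroupOfForm (conjLocal L (IsCMField.complexConj L) v) (cmLocalForm L 3 v))) ∈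
          cmLocalIntegralLevel L 3 (Matrix.of fun i j : Fin 3 => if i.val + j.val + 1 = 3 then (1 : L) else 0) v} := by
  rw [setOf_mem_and_cleanShell_and_labelPlus_eq L v w hw hD]
  exact measureReal_setOf_mem_and_nearTransvShell_and_labelPlus_eq L v w hw μN he hD h2d

include hw in
/-- `μ_N.real{n ∈ K₃ : clean shell ∧ ¬LabelPlus(m*)} = ((1 − q⁻¹)∕2·(q^{(d%2+3d−1)∕2 − d∕2})⁻¹)·μ_N.real{n ∈ K₃}` (the derived road's `T−′`; `∫_N T−′ = ∫_N f_{T+}`).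
[cite: Rogawski1990, §4.9 Prop. 4.9.1 (b) p. 55] [cite: LanglandsShelstad1987, §3] -/
theorem measureReal_setOf_mem_and_cleanShell_and_not_labelPlus_eq [MeasurableSpace ↥(unipotentU (conjLocal L (IsCMField.complexConj L) v) (cmLocalForm L 3 v))] [BorelSpace ↥(unipotentU (conjLocal L (IsCMField.complexConj L) v) (cmLocalForm L 3 v))]
    (μN : Measure ↥(unipotentU (conjLocal L (IsCMField.complexConj L) v) (cmLocalForm L 3 v))) [μN.IsHaarMeasure]
    (he : v.asIdeal.ramificationIdx' w.1.asIdeal ≠ 1) {ϖ : w.1.adicCompletion L} {d t : ℕ}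
    (hD : UnitaryThreeFourFrame.IsRamifiedQuadraticDatum (galAdicCompletionMap (L := L) (IsCMField.complexConj L) hw) ϖ d t) (h2d : 2 ≤ d) :
    μN.real {n : ↥(unipotentU (conjLocal L (IsCMField.complexConj L) v) (cmLocalForm L 3 v)) |
        (n : ↥(unitaryGroupOfForm (conjLocal L (IsCMField.complexConj L) v) (cmLocalForm L 3 v))) ∈
            cmLocalIntegralLevel L 3 (Matrix.of fun i j : Fin 3 => if i.val + j.val + 1 = 3 then (1 : L) else 0) v ∧
          NearTransvShell ϖ (d % 2) (2 * ((d % 2 + 3 * d - 1) / 2))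
            (((n : ↥(unitaryGroupOfForm (conjLocal L (IsCMField.complexConj L) v) (cmLocalForm L 3 v))) : GL (Fin 3) (LocalRing L v)).val.map
                (Pi.evalRingHom (fun w' : PlacesOver L v => w'.1.adicCompletion L) w) - 1) ∧
          ¬ LabelPlus (galAdicCompletionMap (L := L) (IsCMField.complexConj L) hw) ϖ d (d % 2 + 2 * d - 1)
            (((n : ↥(unitaryGroupOfForm (conjLocal L (IsCMField.complexConj L) v) (cmLocalForm L 3 v))) : GL (Fin 3) (LocalRing L v)).val.map
                (Pi.evalRingHom (fun w' : PlacesOver L v => w'.1.adicCompletion L) w) - 1)} =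
      ((1 - ((Ideal.absNorm v.asIdeal : ℝ))⁻¹) / 2 * ((Ideal.absNorm v.asIdeal : ℝ) ^ ((d % 2 + 3 * d - 1) / 2 - d / 2))⁻¹) *
        μN.real {n : ↥(unipotentU (conjLocal L (IsCMField.complexConj L) v) (cmLocalForm L 3 v)) | (n : ↥(unitaryGroupOfForm (conjLocal L (IsCMField.complexConj L) v) (cmLocalForm L 3 v))) ∈
          cmLocalIntegralLevel L 3 (Matrix.of fun i j : Fin 3 => if i.val + j.val + 1 = 3 then (1 : L) else 0) v} := by
  rw [measureReal_def, measureReal_def, ← measure_setOf_mem_and_cleanShell_and_labelPlus_eq_not_labelPlus L v w hw μN he hD h2d, ← measureReal_def, ← measureReal_def,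
    measureReal_setOf_mem_and_cleanShell_and_labelPlus_eq L v w hw μN he hD h2d]

include hw in
/-- **`∫_N f_sgn′ = 0` IN VOLUME FORM**: `μ_N.real{n ∈ K₃ : clean shell ∧ LabelPlus(m*)} − μ_N.real{n ∈ K₃ : clean shell ∧ ¬LabelPlus(m*)} = 0` — the Levi row (3) of the derived
road's clean sign piece `f_sgn′ = f_{T+} − T−′` vanishes near `1` (realised by the EMPTY `H`-family).  [cite: LanglandsShelstad1987, §3] [cite: Rogawski1990, §4.9 Prop. 4.9.1 (b) p. 55] -/
theorem measureReal_cleanShell_labelPlus_sub_not_labelPlus_eq_zero [MeasurableSpace ↥(unipotentU (conjLocal L (IsCMField.complexConj L) v) (cmLocalForm L 3 v))] [BorelSpace ↥(unipotentU (conjLocal L (IsCMField.complexConj L) v) (cmLocalForm L 3 v))]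
    (μN : Measure ↥(unipotentU (conjLocal L (IsCMField.complexConj L) v) (cmLocalForm L 3 v))) [μN.IsHaarMeasure]
    (he : v.asIdeal.ramificationIdx' w.1.asIdeal ≠ 1) {ϖ : w.1.adicCompletion L} {d t : ℕ}
    (hD : UnitaryThreeFourFrame.IsRamifiedQuadraticDatum (galAdicCompletionMap (L := L) (IsCMField.complexConj L) hw) ϖ d t) (h2d : 2 ≤ d) :
    μN.real {n : ↥(unipotentU (conjLocal L (IsCMField.complexConj L) v) (cmLocalForm L 3 v)) |
        (n : ↥(unitaryGroupOfForm (conjLocal L (IsCMField.complexConj L) v) (cmLocalForm L 3 v))) ∈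
            cmLocalIntegralLevel L 3 (Matrix.of fun i j : Fin 3 => if i.val + j.val + 1 = 3 then (1 : L) else 0) v ∧
          NearTransvShell ϖ (d % 2) (2 * ((d % 2 + 3 * d - 1) / 2))
            (((n : ↥(unitaryGroupOfForm (conjLocal L (IsCMField.complexConj L) v) (cmLocalForm L 3 v))) : GL (Fin 3) (LocalRing L v)).val.map
                (Pi.evalRingHom (fun w' : PlacesOver L v => w'.1.adicCompletion L) w) - 1) ∧
          LabelPlus (galAdicCompletionMap (L := L) (IsCMField.complexConj L) hw) ϖ d (d % 2 + 2 * d - 1)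
            (((n : ↥(unitaryGroupOfForm (conjLocal L (IsCMField.complexConj L) v) (cmLocalForm L 3 v))) : GL (Fin 3) (LocalRing L v)).val.map
                (Pi.evalRingHom (fun w' : PlacesOver L v => w'.1.adicCompletion L) w) - 1)} -
        μN.real {n : ↥(unipotentU (conjLocal L (IsCMField.complexConj L) v) (cmLocalForm L 3 v)) |
        (n : ↥(unitaryGroupOfForm (conjLocal L (IsCMField.complexConj L) v) (cmLocalForm L 3 v))) ∈
            cmLocalIntegralLevel L 3 (Matrix.of fun i j : Fin 3 => if i.val + j.val + 1 = 3 then (1 : L) else 0) v ∧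
          NearTransvShell ϖ (d % 2) (2 * ((d % 2 + 3 * d - 1) / 2))
            (((n : ↥(unitaryGroupOfForm (conjLocal L (IsCMField.complexConj L) v) (cmLocalForm L 3 v))) : GL (Fin 3) (LocalRing L v)).val.map
                (Pi.evalRingHom (fun w' : PlacesOver L v => w'.1.adicCompletion L) w) - 1) ∧
          ¬ LabelPlus (galAdicCompletionMap (L := L) (IsCMField.complexConj L) hw) ϖ d (d % 2 + 2 * d - 1)
            (((n : ↥(unitaryGroupOfForm (conjLocal L (IsCMField.complexConj L) v) (cmLocalForm L 3 v))) : GL (Fin 3) (LocalRing L v)).val.map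
                (Pi.evalRingHom (fun w' : PlacesOver L v => w'.1.adicCompletion L) w) - 1)} = 0 := by
  rw [measureReal_setOf_mem_and_cleanShell_and_labelPlus_eq L v w hw μN he hD h2d, measureReal_setOf_mem_and_cleanShell_and_not_labelPlus_eq L v w hw μN he hD h2d, sub_self]

end Summit.HodgeConjecture.HodgeConjecture.Cruxes.H413.F0P3cDyRamCleanSignUnipotentVolume

end
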